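import Literature.AlgebraicGeometry.Motives.AbelianVarietyEtaleIsogenyFrobeniusKernel
import HarnessLib

/-!
# Kernel recognition by rank: `Ker f ⊆ Ker f′` with equal finite flat ranks forces `Ker f = Ker f′`

Topic `Literature/AlgebraicGeometry/GroupSchemes`; namespaces `Literature.AlgebraicGeometry.GroupSchemes.GroupSchemeKernel` (§1, group
objects of `Over S` over any base scheme `S`) and `Literature.AlgebraicGeometry.Motives.AbelianVariety` (§2–§3, the Frobenius form).
THEOREMS ONLY (no definition, no named fact, no instance, no notation, no `sorry`).  Cell `hodgecm-mathlib` (D-0151), FLOOR 0, P6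
«MOD programme» (crux hLiu418 = stmt-HodgeConjecture-24832, `--supports`, count-neutral): organ **(O-δ) «MULT-BLOCK ∕ FROB₀-UNIT»** of
desk F0P6a-plan (g1)'s ORGAN DEALS #1 (2026-09-01), in the RECOGNITION form the heart HFROB consumes: the auxiliary CM factor `A₀` at a
special point satisfies `Ker F_q = Ker ι(π₀)` (HEART-FROB v4.1 §0∕§B: «`A₀[F_q] = A₀[π₀]`, `π₀π̄₀ = q`»), which is the hypothesis
`hker : t ≫ F = 1 ↔ t ≫ ι(π₀) = 1` of ★ `AbelianSchemes/RelFrobeniusVersusEndomorphism`.  The INCLUSION `Ker F_q ⊆ Ker ι(π₀)` is checked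
block by block (★ `AbelianVarietyFrobeniusKernelTorsion` (FK0)∕(ÉT), ★ `AbelianVarietyFrobeniusKernelBlocks` (BLK)); this file turns the
inclusion into an EQUALITY by the rank count `rank Ker F_q = q^{dim A₀} = deg ι(π₀)`, using ★ equal-rank rigidity
(`Morphisms/ClosedImmersionOfEqualRank`).  HC_CM is proved only modulo the printed citations until rung 0 closes; this file is generic and
changes no count.

THE MATHEMATICS.  [GortzWedhorn2020] Definition 4.45 (2) (p. 117): for a homomorphism `f : G → H` of `S`-group schemes the kernel is the
fibre product `Ker f = G ×_{H,e} S`, a closed subgroup scheme of `G` when `H` is separated.  If `f′ : G → H′` is a second homomorphism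
with `Ker f ⊆ Ker f′` (i.e. `ι_{Ker f} ≫ f′ = 1`), the universal property gives a homomorphism `j : Ker f → Ker f′` OVER `G`; since
`j ≫ ι_{Ker f′} = ι_{Ker f}` is a closed immersion and `ι_{Ker f′}` is separated, `j` is a closed immersion.  If moreover `Ker f′ → S` is
finite locally free and `Ker f → S` is flat with the SAME RANK at every point of `S`, then `j` is an isomorphism ([StacksProject] Tag 02KA:
the rank of a finite locally free morphism; a closed immersion of finite flat `S`-schemes of equal rank is an isomorphism — the surjection
of finite flat modules of equal rank `𝒪_{Ker f′} ↠ 𝒪_{Ker f}` is bijective, [Matsumura1987] Thm. 7.10 ∕ Thm. 2.4), so `Ker f = Ker f′` as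
subfunctors of `G`: a `T`-point `t` of `G` is killed by `f` iff it is killed by `f′`.  FROBENIUS FORM ([MumfordAV1970] §15 p. 146: the relative
`q`-Frobenius `F = Fⁿ_{A∕k} : A → A^{(q)}`, `q = pⁿ`, of an abelian variety over a perfect field is an isogeny of degree `q^{dim A}`, so
`Ker F` is finite flat of rank `p^{n·dim A}` — ★ `finrank_ker_relFrobenius_hom`): if a homomorphism `φ` out of `A` kills `Ker F` and `Ker φ`
is finite flat of rank `p^{n·dim A}` (e.g. `φ` an isogeny of that degree), then `Ker F = Ker φ`.

* §1 `kerLift_kerι_comp_kerι`, `isMonHom_kerLift_kerι`, `isClosedImmersion_kerLift_kerι_left`, **`isIso_kerLift_kerι_of_finrank_eq`**,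
  **`comp_eq_one_iff_of_kerι_comp_eq_one_of_finrank_eq`** («KERNEL RECOGNITION BY RANK», any base `S`).
* §2 **`comp_relFrobenius_eq_one_iff_of_kerι_comp_eq_one_of_finrank_eq`** (abelian variety `A` over a perfect field, `φ : A.X ⟶ H′` any
  homomorphism to a separated `k`-group scheme with finite flat kernel of rank `p^{n·dim A}` killing `Ker Fⁿ_{A∕k}`).
* §3 **`comp_relFrobenius_eq_one_iff_of_isIsogeny`** (the same for an isogeny `φ : A ⟶ B` of abelian varieties with `kerRank φ = p^{n·dim A}`).

## References
* [GortzWedhorn2020] U. Görtz, T. Wedhorn, *Algebraic Geometry I: Schemes* (2nd ed., 2020), Definition 4.45 (2) (p. 117).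
* [StacksProject] The Stacks project, Tag 02KA (finite locally free morphisms and their rank), Tag 01WJ (morphisms of finite type ∕ closed
  immersions: `IsClosedImmersion.of_comp`).
* [Matsumura1987] H. Matsumura, *Commutative Ring Theory* (1987), Thm. 2.4 (surjective endomorphisms of finite modules), Thm. 7.10.
* [MumfordAV1970] D. Mumford, *Abelian Varieties* (1970), §15 (p. 146): `F_{A∕k}` is an isogeny of degree `q^{dim A}`.
* [Tate1997FiniteFlatGroupSchemes] J. Tate, *Finite flat group schemes* (in Cornell–Silverman–Stevens 1997), (3.7).
-/

set_option autoImplicit false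

noncomputable section

universe u

open CategoryTheory CategoryTheory.Limits AlgebraicGeometry MonoidalCategory CartesianMonoidalCategory
open scoped MonObj

namespace Literature.AlgebraicGeometry.GroupSchemes.GroupSchemeKernel

/-! ### §1 Kernel recognition by rank, over any base scheme -/

section Recognition

variable {S : Scheme.{u}} {G H H' : Over S} [GrpObj H] [GrpObj H'] (f : G ⟶ H) (f' : G ⟶ H')

/-- The comparison morphism `j := kerLift ι_{Ker f} : Ker f ⟶ Ker f′` supplied by `Ker f ⊆ Ker f′` (`ι_{Ker f} ≫ f′ = 1`) lies OVER `G`: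
`j ≫ ι_{Ker f′} = ι_{Ker f}`. [cite: GortzWedhorn2020, Definition 4.45 (2) (p. 117)] -/
theorem kerLift_kerι_comp_kerι (hle : kerι f ≫ f' = 1) : kerLift (f := f') (kerι f) hle ≫ kerι f' = kerι f :=
  kerLift_ι _ _

/-- The comparison morphism `Ker f ⟶ Ker f′` is a homomorphism of group objects (for homomorphisms `f`, `f′`).
[cite: GortzWedhorn2020, Definition 4.45 (2) (p. 117)] -/
theorem isMonHom_kerLift_kerι [GrpObj G] [IsMonHom f] [IsMonHom f'] (hle : kerι f ≫ f' = 1) :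
    IsMonHom (kerLift (f := f') (kerι f) hle) :=
  isMonHom_kerLift (kerι f) hle

/-- **`Ker f ⟶ Ker f′` is a CLOSED IMMERSION** (targets separated over `S`): `j ≫ ι_{Ker f′} = ι_{Ker f}` is a closed immersion and
`ι_{Ker f′}` is a closed immersion, hence separated (Mathlib `IsClosedImmersion.of_comp`).
[cite: GortzWedhorn2020, Definition 4.45 (2) (p. 117)] [cite: StacksProject, Tag 01WJ] -/
theorem isClosedImmersion_kerLift_kerι_left [IsSeparated H.hom] [IsSeparated H'.hom] (hle : kerι f ≫ f' = 1) :
    IsClosedImmersion (kerLift (f := f') (kerι f) hle).left := by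
  haveI := isClosedImmersion_kerι_left_of_isSeparated f
  haveI := isClosedImmersion_kerι_left_of_isSeparated f'
  haveI : IsClosedImmersion ((kerLift (f := f') (kerι f) hle).left ≫ (kerι f').left) := by
    rw [← Over.comp_left, kerLift_ι]
    infer_instance
  exact IsClosedImmersion.of_comp _ (kerι f').left

/-- **`Ker f ⊆ Ker f′` with EQUAL finite flat RANKS ⟹ `Ker f ⟶ Ker f′` is an ISOMORPHISM**: a closed immersion between finite flat
`S`-schemes of the same rank at every point of `S` is an isomorphism (★ `Morphisms.Over.isIso_of_isClosedImmersion_of_finrank_eq`).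
[cite: StacksProject, Tag 02KA] [cite: Matsumura1987, Thm. 2.4 and Thm. 7.10] [cite: GortzWedhorn2020, Definition 4.45 (2) (p. 117)] -/
theorem isIso_kerLift_kerι_of_finrank_eq [IsSeparated H.hom] [IsSeparated H'.hom]
    [IsFinite (ker f').hom] [Flat (ker f').hom] [Flat (ker f).hom] (hle : kerι f ≫ f' = 1)
    (hrank : ∀ s, (ker f).hom.finrank s = (ker f').hom.finrank s) :
    IsIso (kerLift (f := f') (kerι f) hle) := by
  haveI := isClosedImmersion_kerLift_kerι_left f f' hle
  exact Morphisms.Over.isIso_of_isClosedImmersion_of_finrank_eq _ hrank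

/-- **KERNEL RECOGNITION BY RANK.**  Let `f : G → H`, `f′ : G → H′` be morphisms from a group object of `Over S` to separated group
objects, with `Ker f ⊆ Ker f′` (`ι_{Ker f} ≫ f′ = 1`), `Ker f′ → S` finite flat, `Ker f → S` flat, and EQUAL RANKS at every point of
`S`.  Then `Ker f = Ker f′` as subfunctors of `G`: a `T`-point `t` of `G` is killed by `f` iff it is killed by `f′` (the comparison closed
immersion `Ker f ↪ Ker f′` is an isomorphism). [cite: GortzWedhorn2020, Definition 4.45 (2) (p. 117)] [cite: StacksProject, Tag 02KA]
[cite: Matsumura1987, Thm. 2.4 and Thm. 7.10] -/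
theorem comp_eq_one_iff_of_kerι_comp_eq_one_of_finrank_eq [IsSeparated H.hom] [IsSeparated H'.hom]
    [IsFinite (ker f').hom] [Flat (ker f').hom] [Flat (ker f).hom] (hle : kerι f ≫ f' = 1)
    (hrank : ∀ s, (ker f).hom.finrank s = (ker f').hom.finrank s) {T : Over S} (t : T ⟶ G) :
    t ≫ f = 1 ↔ t ≫ f' = 1 := by
  constructor
  · intro ht
    rw [← kerLift_ι t ht, Category.assoc, hle, MonObj.comp_one]
  · intro ht
    haveI := isIso_kerLift_kerι_of_finrank_eq f f' hle hrank
    -- `ι_{Ker f′} = j⁻¹ ≫ ι_{Ker f}`, so `t = kerLift t ≫ j⁻¹ ≫ ι_{Ker f}` factors through `Ker f`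
    have hι : inv (kerLift (f := f') (kerι f) hle) ≫ kerι f = kerι f' := by
      rw [IsIso.inv_comp_eq, kerLift_ι]
    rw [← kerLift_ι t ht, ← hι, Category.assoc, Category.assoc, kerι_comp, MonObj.comp_one, MonObj.comp_one]

end Recognition

end Literature.AlgebraicGeometry.GroupSchemes.GroupSchemeKernel

/-! ### §2 The Frobenius form: a homomorphism killing `Ker Fⁿ_{A∕k}` with kernel of rank `p^{n·dim A}` HAS kernel `Ker Fⁿ_{A∕k}` -/

namespace Literature.AlgebraicGeometry.Motives.AbelianVariety

open Literature.AlgebraicGeometry.GroupSchemes Literature.AlgebraicGeometry.GroupSchemes.GroupSchemeKernel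

section Frobenius

variable {k : Type u} [Field k] [PerfectField k] (p : ℕ) [ExpChar k p] (n : ℕ) (A : AbelianVariety k)

/-- **FROBENIUS-KERNEL RECOGNITION BY RANK.**  `k` a perfect field of exponential characteristic `p`, `A∕k` an abelian variety,
`F = Fⁿ_{A∕k} : A → A^{(pⁿ)}` its relative `pⁿ`-Frobenius, and `φ : A → H′` a morphism to a separated `k`-group scheme with `Ker φ`
finite flat over `k`.  If `φ` kills `Ker F` (`ι_{Ker F} ≫ φ = 1`, i.e. `Ker F ⊆ Ker φ` — for the CM factor `A₀` of the heart this is the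
block-by-block inclusion «`A₀[F_q] ⊆ A₀[π₀]`», ★ (FK0)∕(ÉT)∕(BLK)) and `rank Ker φ = p^{n·dim A}` (`= rank Ker F`, [MumfordAV1970] §15:
`deg F = q^{dim A}`; ★ `finrank_ker_relFrobenius_hom`), then `Ker F = Ker φ`: for every `k`-scheme `T` and `t ∈ A(T)`,
`t ≫ F = 1 ↔ t ≫ φ = 1` — the hypothesis `hker` of ★ `RelFrobeniusVersusEndomorphism` («`A₀[F_q] = A₀[π₀]`», HEART-FROB §0).
[cite: MumfordAV1970, §15 (p. 146)] [cite: StacksProject, Tag 02KA] [cite: GortzWedhorn2020, Definition 4.45 (2) (p. 117)] -/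
theorem comp_relFrobenius_eq_one_iff_of_kerι_comp_eq_one_of_finrank_eq
    {H' : Over (Spec (.of k))} [GrpObj H'] [IsSeparated H'.hom] (φ : A.X ⟶ H')
    [IsFinite (ker φ).hom] [Flat (ker φ).hom]
    (hle : kerι (A.relFrobenius p n).hom.hom.hom ≫ φ = 1)
    (hdeg : ∀ s, (ker φ).hom.finrank s = p ^ (n * A.dim))
    {T : Over (Spec (.of k))} (t : T ⟶ A.X) :
    t ≫ (A.relFrobenius p n).hom.hom.hom = 1 ↔ t ≫ φ = 1 := by
  haveI := flat_ker_relFrobenius_hom p n A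
  exact comp_eq_one_iff_of_kerι_comp_eq_one_of_finrank_eq (A.relFrobenius p n).hom.hom.hom φ hle
    (fun s => by rw [finrank_ker_relFrobenius_hom p n A, hdeg]) t

/-- The same with the comparison ISOMORPHISM made explicit: `Ker Fⁿ_{A∕k} ⥲ Ker φ` over `A`.
[cite: MumfordAV1970, §15 (p. 146)] [cite: StacksProject, Tag 02KA] -/
theorem isIso_kerLift_kerι_relFrobenius_of_finrank_eq
    {H' : Over (Spec (.of k))} [GrpObj H'] [IsSeparated H'.hom] (φ : A.X ⟶ H')
    [IsFinite (ker φ).hom] [Flat (ker φ).hom]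
    (hle : kerι (A.relFrobenius p n).hom.hom.hom ≫ φ = 1)
    (hdeg : ∀ s, (ker φ).hom.finrank s = p ^ (n * A.dim)) :
    IsIso (kerLift (f := φ) (kerι (A.relFrobenius p n).hom.hom.hom) hle) := by
  haveI := flat_ker_relFrobenius_hom p n A
  exact isIso_kerLift_kerι_of_finrank_eq (A.relFrobenius p n).hom.hom.hom φ hle
    (fun s => by rw [finrank_ker_relFrobenius_hom p n A, hdeg])

end Frobenius

/-! ### §3 The isogeny form: degree `p^{n·dim A}` and `Ker F ⊆ Ker φ` ⟹ `Ker F = Ker φ` -/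

section Isogeny

variable {k : Type u} [Field k] [PerfectField k] (p : ℕ) [ExpChar k p] (n : ℕ) {A B : AbelianVariety k} (φ : A ⟶ B)

omit [PerfectField k] in
/-- The kernel of an ISOGENY `φ : A → B` is finite flat over `k` of rank `kerRank φ` at every point (★ `IsIsogeny.finrank_eq_kerRank` read on
the kernel square, ★ `finrank_ker_hom_eq_finrank_left`). [cite: MumfordAV1970, §7 Application 3 (p. 63)] [cite: StacksProject, Tag 02KA] -/
theorem finrank_ker_hom_of_isIsogeny (hφ : IsIsogeny φ) (s : ↥(Spec (.of k))) :
    (ker φ.hom.hom.hom).hom.finrank s = Hom.kerRank φ := by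
  haveI : IsFinite φ.hom.hom.hom.left := hφ.2
  haveI : Flat φ.hom.hom.hom.left := IsIsogeny.flat_toSchemeHom_holds hφ
  rw [finrank_ker_hom_eq_finrank_left φ.hom.hom.hom s]
  exact hφ.finrank_eq_kerRank _

/-- **FROBENIUS-KERNEL RECOGNITION, ISOGENY FORM.**  `k` perfect of exponential characteristic `p`, `φ : A → B` an ISOGENY of abelian
varieties over `k` of degree `kerRank φ = p^{n·dim A}` which kills `Ker Fⁿ_{A∕k}` (`ι_{Ker F} ≫ φ = 1`).  Then `Ker Fⁿ_{A∕k} = Ker φ`: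
`t ≫ F = 1 ↔ t ≫ φ = 1` for every `T`-point `t` of `A`.  (HEART-FROB §0: `φ = ι(π₀)` on the CM factor `A₀`, `π₀π̄₀ = q`,
`deg ι(π₀) = N(π₀)^{h} = q^{dim A₀}`.) [cite: MumfordAV1970, §15 (p. 146) and §7 Application 3 (p. 63)] [cite: StacksProject, Tag 02KA] -/
theorem comp_relFrobenius_eq_one_iff_of_isIsogeny (hφ : IsIsogeny φ) (hdeg : Hom.kerRank φ = p ^ (n * A.dim))
    (hle : kerι (A.relFrobenius p n).hom.hom.hom ≫ φ.hom.hom.hom = 1)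
    {T : Over (Spec (.of k))} (t : T ⟶ A.X) :
    t ≫ (A.relFrobenius p n).hom.hom.hom = 1 ↔ t ≫ φ.hom.hom.hom = 1 := by
  haveI : IsFinite φ.hom.hom.hom.left := hφ.2
  haveI : Flat φ.hom.hom.hom.left := IsIsogeny.flat_toSchemeHom_holds hφ
  haveI := isFinite_ker_hom_of_isFinite_left φ.hom.hom.hom
  haveI := flat_ker_hom_of_flat_left φ.hom.hom.hom
  exact comp_relFrobenius_eq_one_iff_of_kerι_comp_eq_one_of_finrank_eq p n A φ.hom.hom.hom hle
    (fun s => by rw [finrank_ker_hom_of_isIsogeny φ hφ, hdeg]) t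

end Isogeny

end Literature.AlgebraicGeometry.Motives.AbelianVariety

end
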